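import Summits.BirchSwinnertonDyer.Rank1Residual.F1Sign2.TwistedMarkedSelmerLawAtTwo
import HarnessLib

/-!
# Cell `bsd-f1-sign2` — kernel for `F1Sign2/TwistedMarkedSelmerLawAtTwo.lean` (-an §24.17/§24.18/§24.21: S38r / S38s / S38t and REF1's S38r♮ / S38t′)

THEOREMS ONLY (no `def`, no `sorry`, no named fact; ns `…F1Sign2.ANg21`).  Contents: (1) REF1 §184's sorry-free certificates from `HOME/REF1-data/b184/lean/Probe184.lean`
35a57b4b13d7a799 VERBATIM (ns `REF1g17c` → `ANg21`): T184a `markedChar_span_natCast_eq_one` (the Frobenius clause of S38r/S38s is VACUOUS: every marked character with empty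
archimedean marking is 1 on `(ℓ)`, `ℓ` odd), T184b `card_markedChar_frob_eq`, T184b′ `card_markedChar_allFrob_eq`, C184a `twistedInert_iff_bare : S38r ↔ S38r♮`, C184b
`twistedInert_selmer_eq` (S38n ∧ S38r ⟹ `#Sel₂(W′) = #Sel₂(W)`: inert-twist invariance of the 2-Selmer cardinality), T184c `heegnerClause_at_two_of_odd` (S38t's `ZMod 2`
Heegner clause is void for odd `D`), T184d `emod_examples` (`D % 4 = 1` under `Int.emod` for negative `D`; `−3 % 8 = 5`); (2) typer glue: `primeStar_bookkeeping` (for an odd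
prime `ℓ ∤ 2N`: `ℓ* = (−1)^{(ℓ−1)/2} ℓ` is squarefree, `≡ 1 (4)`, coprime to `2N`, has `ℓ` as only prime divisor, and casts to S38r's twist parameter),
**`twistedAllInert_implies_inert : TwistedAllInert_implies_Inert`** (-an's v65 bookkeeping S38s ⟹ S38r, PROVED — REF1 §184 «left to -ty»), `isCoprime_two_of_emod_eight`, and
**`markedHeegnerTwin_of_selmerCardTwo : S38t′ → S38n → S38t`** (REF1 R184b «S38t = S38t′ ∘ (S38n + GZK)»: S38n turns `#M(∅) = 2` into `#Sel₂(W) = 2`, `D ≡ 1 (8)` and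
`(D, N) = 1` give -an's `D ≡ 1 (4)` and `(D, 2N) = 1`).  Typer -ty g17; std axioms {propext, Classical.choice, Quot.sound} on the farm.  BSD is not proved by this; no item
closed; PARTITION none.
-/

namespace Summit.BirchSwinnertonDyer.Rank1Residual.F1Sign2.ANg21

open Literature.NumberTheory.EllipticCurves Literature.NumberTheory.EllipticCurves.ModularForms UpperHalfPlane
open Literature.NumberTheory.EllipticCurves.Rank1Residual
open Summit.BirchSwinnertonDyer.Rank1Residual.F1Sign2 Summit.BirchSwinnertonDyer.Rank1Residual.F1Sign2.ANg17
open Summit.BirchSwinnertonDyer.Rank1Residual.F1Sign2.ANg18 Summit.BirchSwinnertonDyer.Rank1Residual.F1Sign2.ANg19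
open Summit.BirchSwinnertonDyer.Rank1Residual.F1Sign2.ANg20
open scoped Classical

section TwistedLaw
open NumberField

/-! ## REF1 §184 certificates (`HOME/REF1-data/b184/lean/Probe184.lean` 35a57b4b13d7a799 l.854–916 and l.929–962, VERBATIM; ns `REF1g17c` → `ANg21`) -/

/-- **T184a (the Frobenius clause of S38r/S38s is VACUOUS).** For any odd natural number `ℓ`, EVERY marked quadratic character with empty
archimedean marking takes the value `1` on the principal ideal `(ℓ)`: `(ℓ) = (±ℓ)` with `±ℓ ≡ 1 (mod 4)`, `4 ∈ 𝔭²` for every `𝔭 ∣ 2`, and no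
sign condition.  Hence `{χ ∈ M(∅) : χ((ℓ)) = 1} = M(∅)`. -/
theorem markedChar_span_natCast_eq_one (F : Type) [Field F] [NumberField F] (θ : 𝓞 F)
    (χ : Ideal (𝓞 F) → ℤˣ) (hχ : χ ∈ markedQuadraticCharacters F θ ∅) (ℓ : ℕ) (hℓ : Odd ℓ) :
    χ (Ideal.span {(ℓ : 𝓞 F)}) = 1 := by
  obtain ⟨-, -, hray⟩ := hχ
  -- no prime over 2 contains an odd integer
  have hcop : ∀ a : 𝓞 F, (∃ b : 𝓞 F, a = 2 * b + 1 ∨ a = -(2 * b + 1)) →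
      ∀ P : Ideal (𝓞 F), P.IsPrime → (2 : 𝓞 F) ∈ P → a ∉ P := by
    rintro a ⟨b, hb⟩ P hP h2 ha
    apply hP.ne_top
    rw [Ideal.eq_top_iff_one]
    have h2b : 2 * b ∈ P := P.mul_mem_right b h2
    rcases hb with rfl | rfl
    · simpa using P.sub_mem ha h2b
    · have : 2 * b + 1 ∈ P := by simpa using P.neg_mem_iff.mp (by simpa using ha)
      simpa using P.sub_mem this h2b
  have h4 : ∀ P : Ideal (𝓞 F), (2 : 𝓞 F) ∈ P → ∀ c : 𝓞 F, 4 * c ∈ P ^ 2 := by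
    intro P h2 c
    have : (2 : 𝓞 F) * 2 ∈ P ^ 2 := by rw [pow_two]; exact Ideal.mul_mem_mul h2 h2
    have h := (P ^ 2).mul_mem_right c this
    convert h using 1; ring
  obtain ⟨k, hk⟩ := hℓ
  rcases Nat.even_or_odd k with ⟨m, hm⟩ | ⟨m, hm⟩
  · -- ℓ = 4m + 1
    have ha : ((ℓ : 𝓞 F)) = 2 * (2 * (m : 𝓞 F)) + 1 := by rw [hk, hm]; push_cast; ring
    apply hray
    · exact_mod_cast (show ℓ ≠ 0 by omega)
    · exact hcop _ ⟨2 * (m : 𝓞 F), Or.inl ha⟩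
    · intro P _ h2 _
      have : (ℓ : 𝓞 F) - 1 = 4 * (m : 𝓞 F) := by rw [ha]; ring
      rw [this]; exact h4 P h2 _
    · simp
  · -- ℓ = 4m + 3: use the generator -ℓ ≡ 1 (mod 4)
    have ha : (-(ℓ : 𝓞 F)) = -(2 * (2 * (m : 𝓞 F) + 1) + 1) := by rw [hk, hm]; push_cast; ring
    rw [← Ideal.span_singleton_neg]
    apply hray
    · exact neg_ne_zero.mpr (by exact_mod_cast (show ℓ ≠ 0 by omega))
    · exact hcop _ ⟨2 * (m : 𝓞 F) + 1, Or.inr ha⟩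
    · intro P _ h2 _
      have : (-(ℓ : 𝓞 F)) - 1 = 4 * (-((m : 𝓞 F) + 1)) := by rw [hk, hm]; push_cast; ring
      rw [this]; exact h4 P h2 _
    · simp

/-- T184b: the counted set of S38r equals the full marked set (so S38r's right-hand side is `#M(∅)`, i.e. `#Sel₂(W)` under S38n). -/
theorem card_markedChar_frob_eq (F : Type) [Field F] [NumberField F] (θ : 𝓞 F) (ℓ : ℕ) (hℓ : Odd ℓ) :
    Nat.card {χ : Ideal (𝓞 F) → ℤˣ // χ ∈ markedQuadraticCharacters F θ ∅ ∧ χ (Ideal.span {(ℓ : 𝓞 F)}) = 1}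
      = Nat.card (markedQuadraticCharacters F θ ∅) := by
  apply Nat.card_congr
  exact Equiv.subtypeEquivRight (fun χ => ⟨fun h => h.1, fun h => ⟨h, markedChar_span_natCast_eq_one F θ χ h ℓ hℓ⟩⟩)

/-- T184b′: the same for S38s (every prime factor of `D ≡ 1 (mod 4)` is odd). -/
theorem card_markedChar_allFrob_eq (F : Type) [Field F] [NumberField F] (θ : 𝓞 F) (D : ℤ) (hD : D % 4 = 1) :
    Nat.card {χ : Ideal (𝓞 F) → ℤˣ // χ ∈ markedQuadraticCharacters F θ ∅ ∧
        ∀ ℓ : ℕ, ℓ.Prime → (ℓ : ℤ) ∣ D → χ (Ideal.span {(ℓ : 𝓞 F)}) = 1}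
      = Nat.card (markedQuadraticCharacters F θ ∅) := by
  apply Nat.card_congr
  refine Equiv.subtypeEquivRight (fun χ => ⟨fun h => h.1, fun h => ⟨h, fun ℓ hp hdvd => ?_⟩⟩)
  apply markedChar_span_natCast_eq_one F θ χ h ℓ
  rcases hp.eq_two_or_odd' with rfl | hodd
  · exfalso; omega
  · exact hodd

/-- C184a: S38r ⟺ S38r♮ (kernel; the Frobenius clause never cuts). -/
theorem twistedInert_iff_bare : TwistedSelmerLawInertNegDisc ↔ TwistedSelmerLawInertNegDiscBare := by
  constructor
  · intro h W _ _ hN ht h2 hD F _ _ hF x₁ hx θ hθ ℓ hp hℓ2 hℓN hI W' _ hW'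
    rw [h W hN ht h2 hD F hF x₁ hx θ hθ ℓ hp hℓ2 hℓN hI W' hW']
    exact card_markedChar_frob_eq F θ ℓ ((hp.eq_two_or_odd').resolve_left hℓ2)
  · intro h W _ _ hN ht h2 hD F _ _ hF x₁ hx θ hθ ℓ hp hℓ2 hℓN hI W' _ hW'
    rw [h W hN ht h2 hD F hF x₁ hx θ hθ ℓ hp hℓ2 hℓN hI W' hW']
    exact (card_markedChar_frob_eq F θ ℓ ((hp.eq_two_or_odd').resolve_left hℓ2)).symm

/-- C184b: under S38n, S38r says exactly `#Sel₂(W') = #Sel₂(W)` (inert-twist invariance of the 2-Selmer cardinality). -/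
theorem twistedInert_selmer_eq (hn : TwoSelmerIsMarkedTwoDivisionFieldNegDisc) (hr : TwistedSelmerLawInertNegDisc)
    (W : WeierstrassCurve ℚ) [W.IsElliptic] [W.IsGloballyMinimal]
    (hN : Squarefree (W.conductorNorm ℤ)) (ht : Odd W.tamagawaProduct) (h2 : NoRationalTwoTorsion W) (hD : W.Δ < 0)
    (F : Type) [Field F] [NumberField F] (hF : IsCubicTwoDivisionField W F)
    (x₁ : F) (hx : (W.baseChange F).twoTorsionPolynomial.toPoly.IsRoot x₁) (θ : 𝓞 F) (hθ : (θ : F) = 4 * x₁)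
    (ℓ : ℕ) (hp : ℓ.Prime) (hℓ2 : ℓ ≠ 2) (hℓN : ¬ (ℓ ∣ W.conductorNorm ℤ)) (hI : (Ideal.span {(ℓ : 𝓞 F)}).IsPrime)
    (W' : WeierstrassCurve ℚ) [W'.IsElliptic]
    (hW' : ∃ C : WeierstrassCurve.VariableChange ℚ, C • W.quadraticTwist ((-1 : ℚ) ^ ((ℓ - 1) / 2) * ℓ) = W') :
    Nat.card (W'.selmerGroup 2) = Nat.card (W.selmerGroup 2) := by
  rw [twistedInert_iff_bare.mp hr W hN ht h2 hD F hF x₁ hx θ hθ ℓ hp hℓ2 hℓN hI W' hW', hn W hN ht h2 hD F hF x₁ hx θ hθ]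

/-- T184c (S38t, Heegner clause at `p = 2`): for odd `D` the clause `∃ s : ZMod 2, s ≠ 0 ∧ s² = D` always holds — it does NOT say that `2`
splits in `ℚ(√D)` (which needs `D ≡ 1 (mod 8)`); so on the even-conductor face the typed Heegner hypothesis is weaker than intended. -/
theorem heegnerClause_at_two_of_odd (D : ℤ) (hD : Odd D) : ∃ s : ZMod 2, s ≠ 0 ∧ s ^ 2 = (D : ZMod 2) := by
  refine ⟨1, by decide, ?_⟩
  obtain ⟨k, rfl⟩ := hD
  push_cast
  have : (2 : ZMod 2) = 0 := by decide
  rw [this]; ring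

/-- T184d: `D % 4 = 1` is the right congruence also for negative `D` under Lean's `Int.emod` (e.g. `D = -7`, `-15`), and `-3 % 8 = 5`:
a prime Heegner discriminant `-q` with `q ≡ 3 (mod 8)` passes S38t's clauses at an even conductor although `2` is inert in `ℚ(√-q)`. -/
theorem emod_examples : (-7 : ℤ) % 4 = 1 ∧ (-15 : ℤ) % 4 = 1 ∧ (-3 : ℤ) % 4 = 1 ∧ (-3 : ℤ) % 8 = 5 := by decide

/-! ## Typer glue: -an's bookkeeping `TwistedAllInert_implies_Inert` (S38s ⟹ S38r) PROVED, and S38t′ ∧ S38n ⟹ S38t -/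

/-- For an odd prime `ℓ`, `ℓ* := (−1)^{(ℓ−1)/2}·ℓ ≡ 1 (mod 4)` is squarefree, coprime to `2N` when `ℓ ∤ 2N`, its only prime divisor is `ℓ`, and
`(ℓ* : ℚ)` is the twist parameter of S38r.  Bookkeeping for `twistedAllInert_implies_inert`. -/
theorem primeStar_bookkeeping (ℓ : ℕ) (hp : ℓ.Prime) (hℓ2 : ℓ ≠ 2) (N : ℕ) (hℓN : ¬ ℓ ∣ N) :
    let D : ℤ := (-1) ^ ((ℓ - 1) / 2) * ℓ
    Squarefree D ∧ D % 4 = 1 ∧ IsCoprime D (2 * (N : ℤ)) ∧ (∀ p : ℕ, p.Prime → (p : ℤ) ∣ D → p = ℓ) ∧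
      ((D : ℚ) = (-1 : ℚ) ^ ((ℓ - 1) / 2) * ℓ) := by
  intro D
  have hodd : Odd ℓ := hp.eq_two_or_odd'.resolve_left hℓ2
  have hcopN : IsCoprime (ℓ : ℤ) (2 * (N : ℤ)) := by
    have h : Nat.Coprime ℓ (2 * N) :=
      Nat.Coprime.mul_right ((Nat.coprime_primes hp Nat.prime_two).mpr hℓ2) ((Nat.Prime.coprime_iff_not_dvd hp).mpr hℓN)
    have := Nat.isCoprime_iff_coprime.mpr h
    push_cast at this
    exact this
  have hsqℓ : Squarefree (ℓ : ℤ) := Int.squarefree_natCast.mpr hp.squarefree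
  have hcast : ((D : ℚ) = (-1 : ℚ) ^ ((ℓ - 1) / 2) * ℓ) := by
    show (((-1 : ℤ) ^ ((ℓ - 1) / 2) * ℓ : ℤ) : ℚ) = _
    push_cast; ring
  obtain ⟨k, hk⟩ := hodd
  rcases Nat.even_or_odd ((ℓ - 1) / 2) with he | ho
  · have hD : D = ℓ := by show (-1 : ℤ) ^ ((ℓ - 1) / 2) * ℓ = ℓ; rw [he.neg_one_pow, one_mul]
    obtain ⟨m, hm⟩ := he
    refine ⟨hD ▸ hsqℓ, by rw [hD]; omega, hD ▸ hcopN, fun p hp' hpd => ?_, hcast⟩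
    rw [hD, Int.natCast_dvd_natCast] at hpd
    exact (Nat.prime_dvd_prime_iff_eq hp' hp).mp hpd
  · have hD : D = -ℓ := by show (-1 : ℤ) ^ ((ℓ - 1) / 2) * ℓ = -ℓ; rw [ho.neg_one_pow]; ring
    obtain ⟨m, hm⟩ := ho
    refine ⟨?_, by rw [hD]; omega, hD ▸ hcopN.neg_left, fun p hp' hpd => ?_, hcast⟩
    · rw [hD, ← Int.squarefree_natAbs, Int.natAbs_neg, Int.natAbs_natCast]; exact hp.squarefree
    · rw [hD, dvd_neg, Int.natCast_dvd_natCast] at hpd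
      exact (Nat.prime_dvd_prime_iff_eq hp' hp).mp hpd

/-- **-an's bookkeeping `TwistedAllInert_implies_Inert` PROVED (REF1 §184: «true, routine, unproved in v65; left to -ty»): S38s specialises to S38r at `D = ℓ*`.**
Both counted sets equal `#M(∅)` (REF1 T184b / T184b′), so the two right-hand sides agree; the twist parameters agree by `primeStar_bookkeeping`. -/
theorem twistedAllInert_implies_inert : TwistedAllInert_implies_Inert := by
  intro hs W _ _ hN ht h2 hΔ F _ _ hF x₁ hx θ hθ ℓ hp hℓ2 hℓN hI W' _ hW'
  obtain ⟨hsq, h4, hcop, hpr, hcast⟩ := primeStar_bookkeeping ℓ hp hℓ2 (W.conductorNorm ℤ) hℓN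
  have hinert : ∀ p : ℕ, p.Prime → (p : ℤ) ∣ (-1) ^ ((ℓ - 1) / 2) * (ℓ : ℤ) → (Ideal.span {(p : 𝓞 F)}).IsPrime := by
    intro p hp' hpd
    rw [hpr p hp' hpd]
    exact hI
  have hW'' : ∃ C : WeierstrassCurve.VariableChange ℚ, C • W.quadraticTwist ((((-1) ^ ((ℓ - 1) / 2) * (ℓ : ℤ) : ℤ)) : ℚ) = W' := by
    rw [hcast]; exact hW'
  rw [hs W hN ht h2 hΔ F hF x₁ hx θ hθ _ hsq h4 hcop hinert W' hW'', card_markedChar_allFrob_eq F θ _ h4,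
    card_markedChar_frob_eq F θ ℓ (hp.eq_two_or_odd'.resolve_left hℓ2)]

/-- `D ≡ 1 (mod 8)` integers are coprime to `2` (and `≡ 1 (mod 4)`). -/
theorem isCoprime_two_of_emod_eight {D : ℤ} (hD : D % 8 = 1) : IsCoprime D 2 := by
  refine ⟨1, -4 * (D / 8), ?_⟩
  omega

/-- **Glue: S38t′ ∧ S38n ⟹ -an's S38t `MarkedHeegnerTwinExists` verbatim** (REF1 R184b: «S38t = S38t′ ∘ (S38n + GZK) on the class»; S38n turns `#M(∅) = 2`
into `#Sel₂(W) = 2`, S38t′ supplies a `D ≡ 1 (mod 8)` twin, and `D ≡ 1 (8)` + `(D, N) = 1` give -an's `D ≡ 1 (4)` + `(D, 2N) = 1`). -/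
theorem markedHeegnerTwin_of_selmerCardTwo (h : HeegnerTwinExistsOfTwoSelmerCardTwo) (hn : TwoSelmerIsMarkedTwoDivisionFieldNegDisc) :
    MarkedHeegnerTwinExists := by
  intro W _ _ hN ht h2 hΔ _ F _ _ hF x₁ hx θ hθ hM
  have hsel : Nat.card (W.selmerGroup 2) = 2 := by rw [hn W hN ht h2 hΔ F hF x₁ hx θ hθ, hM]
  obtain ⟨D, hD0, hsq, h8, hcop, hheeg, htwin⟩ := h W h2 hΔ hsel
  refine ⟨D, hD0, hsq, by omega, ?_, hheeg, htwin⟩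
  exact (isCoprime_two_of_emod_eight h8).mul_right hcop

end TwistedLaw

end Summit.BirchSwinnertonDyer.Rank1Residual.F1Sign2.ANg21
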